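import Summits.Ventures.AbcSig.Rows.XTemplateC2a
import Summits.Ventures.AbcSig.Levels.N7552
import Summits.Ventures.AbcSig.Levels.N118

/-!
# Venture AbcSig — ROW `C2aL59A1V2`: `xⁿ + 2·59^m·yⁿ = z²`, class `a = 1`, over NORM-FORM level certificates (GENERATED by p-lean g4 `gen4/c2arow.py`)

HONEST FRAMING. A row of a COMPUTATION cell (`pub-abcsig`); a CONDITIONAL theorem, no claim on ABC or any summit.
Hypotheses: `BS04Package` (CITED: [BS04] Lemma 3.3 + (3.1) + Lemma 4.2); `DataComplete` at the levels 128·59 = 7552 (norm-form level file, `Sieve/CharpolyCert.lean`, with the COMPUTED `RefinesCPSymAll 7552`) and 2·59 = 118 (ordinary tree certificates);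
and the listed per-orbit exclusions `hX_…` (CITED: the row of record's module M8 'level-drop by congruence' closures, lead RULING M8 /
lit/M8-PIN.md, engine-2 + p1 second implementation + referee third reading — nothing of M8 is checked here).
Exponent range: prime `n ≥ 11`, `n ≠ 59`, n ∉ [11]; `B = 2·59^m` with `1 ≤ m < n` (RULING H1 reduced exponents).
Residual of record v2 = {11} (7552.1–.4, .9–.12 and 118.2 at n = 11: M4 leaves classes) is EXCLUDED in the statement (hres). CITED (module M8): 7552.9–.12 at n = 37 and 7552.13/.14/.19/.20 (degree 13) at n = 23. Everything else in the kernel (norm-form certificates at 7552 incl. prime-ideal trees for 7552.15–.18 @ 13; ordinary certificates at 118). v1 residual was {11, 23, 37}.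
Row of record: `census/rows/C2a/C2a-l59-a1.md` (v2 = superseding revision; sha16 `ec916eb9a7442e6a`; v2 R8-signed 2026-08-23T01:59Z by referee (ref-g23)).
-/

namespace Summit.Ventures.AbcSig

/-- Row `C2aL59A1V2`: class `a = 1`, first distribution, prime `n ≥ 11`, `n ≠ 59`, `n ∉ [11]`; conditional on the named hypotheses. -/
theorem xrow_C2aL59A1V2 (M : NewformModel) (hP : M.BS04Package)
    (hD118 : M.DataComplete 118 level118Orbits)
    (hD7552 : M.DataComplete 7552 level7552Orbits) (hCP7552 : M.RefinesCPSymAll 7552 level7552CP)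
    (n : ℕ) (hn : n.Prime) (hmin : 11 ≤ n) (hnℓ : n ≠ 59) (hres : n ∉ ([11] : List ℕ)) (m : ℕ) (hm : 1 ≤ m) (hmn : m < n)
    (hX_orbit_7552_9 : n ∈ ([37] : List ℕ) → M.Excludes 7552 orbit_7552_9
      (famB (2 ^ 1 * 59 ^ m) n (fun _ _ => True)))
    (hX_orbit_7552_10 : n ∈ ([37] : List ℕ) → M.Excludes 7552 orbit_7552_10
      (famB (2 ^ 1 * 59 ^ m) n (fun _ _ => True)))
    (hX_orbit_7552_11 : n ∈ ([37] : List ℕ) → M.Excludes 7552 orbit_7552_11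
      (famB (2 ^ 1 * 59 ^ m) n (fun _ _ => True)))
    (hX_orbit_7552_12 : n ∈ ([37] : List ℕ) → M.Excludes 7552 orbit_7552_12
      (famB (2 ^ 1 * 59 ^ m) n (fun _ _ => True)))
    (hX_orbit_7552_13 : n ∈ ([23] : List ℕ) → M.Excludes 7552 orbit_7552_13
      (famB (2 ^ 1 * 59 ^ m) n (fun _ _ => True)))
    (hX_orbit_7552_14 : n ∈ ([23] : List ℕ) → M.Excludes 7552 orbit_7552_14
      (famB (2 ^ 1 * 59 ^ m) n (fun _ _ => True)))
    (hX_orbit_7552_19 : n ∈ ([23] : List ℕ) → M.Excludes 7552 orbit_7552_19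
      (famB (2 ^ 1 * 59 ^ m) n (fun _ _ => True)))
    (hX_orbit_7552_20 : n ∈ ([23] : List ℕ) → M.Excludes 7552 orbit_7552_20
      (famB (2 ^ 1 * 59 ^ m) n (fun _ _ => True)))
    (x y z : ℤ) (hxy1 : x * y ≠ 1) (hxy2 : x * y ≠ -1) : ¬ IsPrimitiveSolution 1 (2 ^ 1 * 59 ^ m) 1 n x y z := by
  have hℓ : Nat.Prime 59 := by norm_num
  have h7 : 7 ≤ n := by omega
  exact xrowC2a_a1 59 hℓ (by norm_num) M hP n hn h7 hnℓ hD7552 hD118 m hm hmn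
    (level7552_sieve M hP hCP7552 n hn h7 (fun o => M.Excludes 7552 o
      (famB (2 ^ 1 * 59 ^ m) n (fun _ _ => True)) ∨ M.ExcludesStd 7552 o n) (fun _ h => Or.inr h) (fun hmem => by
      rcases (by simpa using hmem : n = 7 ∨ n = 11) with rfl | rfl
      · omega
      · exact absurd (by simp) hres) (fun hmem => by
      rcases (by simpa using hmem : n = 7 ∨ n = 11) with rfl | rfl
      · omega
      · exact absurd (by simp) hres) (fun hmem => by
      rcases (by simpa using hmem : n = 7 ∨ n = 11) with rfl | rfl
      · omega
      · exact absurd (by simp) hres) (fun hmem => by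
      rcases (by simpa using hmem : n = 7 ∨ n = 11) with rfl | rfl
      · omega
      · exact absurd (by simp) hres) (fun hmem => by
      rcases (by simpa using hmem : n = 11 ∨ n = 37) with rfl | rfl
      · exact absurd (by simp) hres
      · exact Or.inl (hX_orbit_7552_9 (by simp))) (fun hmem => by
      rcases (by simpa using hmem : n = 11 ∨ n = 37) with rfl | rfl
      · exact absurd (by simp) hres
      · exact Or.inl (hX_orbit_7552_10 (by simp))) (fun hmem => by
      rcases (by simpa using hmem : n = 11 ∨ n = 37) with rfl | rfl
      · exact absurd (by simp) hres
      · exact Or.inl (hX_orbit_7552_11 (by simp))) (fun hmem => by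
      rcases (by simpa using hmem : n = 11 ∨ n = 37) with rfl | rfl
      · exact absurd (by simp) hres
      · exact Or.inl (hX_orbit_7552_12 (by simp))) (fun hmem => by
      obtain rfl : n = 23 := by simpa using hmem
      exact Or.inl (hX_orbit_7552_13 (by simp))) (fun hmem => by
      obtain rfl : n = 23 := by simpa using hmem
      exact Or.inl (hX_orbit_7552_14 (by simp))) (fun hmem => by
      obtain rfl : n = 7 := by simpa using hmem
      omega) (fun hmem => by
      obtain rfl : n = 7 := by simpa using hmem
      omega) (fun hmem => by
      obtain rfl : n = 7 := by simpa using hmem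
      omega) (fun hmem => by
      obtain rfl : n = 7 := by simpa using hmem
      omega) (fun hmem => by
      obtain rfl : n = 23 := by simpa using hmem
      exact Or.inl (hX_orbit_7552_19 (by simp))) (fun hmem => by
      obtain rfl : n = 23 := by simpa using hmem
      exact Or.inl (hX_orbit_7552_20 (by simp))))
    (level118_sieve n hn h7 (fun o => M.Excludes 118 o
      (famB (2 ^ 1 * 59 ^ m) n (fun _ _ => True)) ∨ M.ExcludesStd 118 o n) (fun hmem => by
      obtain rfl : n = 7 := by simpa using hmem
      omega) (fun hmem => by
      rcases (by simpa using hmem : n = 7 ∨ n = 11) with rfl | rfl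
      · omega
      · exact absurd (by simp) hres))
    x y z hxy1 hxy2

end Summit.Ventures.AbcSig
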